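import Summits.BirchSwinnertonDyer.Rank1Residual.P2.CongruentNumberEvenAokiMonskyDoors
import Summits.BirchSwinnertonDyer.Rank1Residual.P2.CongruentNumberThetaStarTowersBSD
import HarnessLib

/-!
# Cell `bsd-monsky` (prover-B): THE 𝒮⁻-TOWERS RELATIVE TO {`tyz_cmPointGaloisData`, TYZ Thm 1.1, GZK, AOKI Thm 2.2}
# — Monsky's even matrix theorem (`hMe`, printed as a sketch) replaced by Aoki's refereed Theorem 2.2 (`hAo`)
# through «Aoki = Monsky for every k» (kernel theorem; nothing asserted)

HONEST FRAMING (cell `bsd-monsky`, run/shared/lean/pub/bsd-monsky/; README §1/§3): the cell's CLAIMED theorem is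
Monsky's 1990 conjecture on `𝒮⁻` (`k = 2`); the towers are the README §3 record «what the same argument gives»
uniformly in the number of prime factors, NOT part of Theorem 1.1/1.2, NOT refereed. This file asserts NO
arithmetic fact: it re-derives the two tower theorems of `…ThetaStarTowersBSD.lean` with the `2`-Selmer input
DISPLAYED (`hSel`: `#Sel₂(E_{2p₁⋯p_k}) = 2^{2+s}` on `n ≡ 6 (mod 8)`, the shape of HB94's even formula) and then
DISCHARGED from Aoki's Theorem 2.2 by `AokiMonsky.monskyEven_six_of_aoki` (`…EvenAokiMonskyAllPrimes.lean`:
Aoki's closed formula = `2 + s(n)` for every `k`). Net effect on the flags of record: the uniform-in-`k` family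
theorems of route B rest on {`tyz_cmPointGaloisData`, `thm11_parity_of_scriptL`, GZK, `thm22_card_selmerGroup_two`}
— no HB94-even-sketch input.

* `rankOne_sha_bsdp_two_tower_of_cmPointGaloisData_of_selmerSix` / `…_of_aoki` — `ord = 1`, rank `1`,
  `Ш[2^∞] = 0`, `BSD(E_n, 2)` on the towers `n = 2qp₁⋯p_m` (vector form);
* `rankOne_sha_bsdp_two_sminus_tower_of_aoki` — THE 𝒮⁻-TOWER THEOREM on the Legendre symbols, every `m`.

References: [Aoki1999] Thm. 2.2 p. 81; [TianYuanZhang2017] §1 (1.1), Thm. 1.1, Thm. 3.5; [Monsky1990MockHeegner]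
p. 67 Remark (3); [SilvermanAEC2009] Thm. X.4.2; [Miller2011LMS] Def. 1.1; [IrelandRosen1990] Ch. 5 §2.
-/

noncomputable section

open scoped Classical

open Matrix Finset WeierstrassCurve Literature.NumberTheory.EllipticCurves
  Literature.NumberTheory.EllipticCurves.Rank1Residual
  Literature.NumberTheory.EllipticCurves.Rank1Residual.Typed
  Literature.NumberTheory.EllipticCurves.HeathBrown1994
  Literature.NumberTheory.EllipticCurves.HeathBrown1994.Families
  Literature.NumberTheory.EllipticCurves.Aoki1999
  Literature.NumberTheory.EllipticCurves.Tian2014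
  Literature.NumberTheory.EllipticCurves.TianYuanZhang2017
  Literature.NumberTheory.EllipticCurves.TianYuanZhang2017.W2
  Literature.NumberTheory.QuadraticFields.RedeiReichardt

set_option autoImplicit false

namespace Summit.BirchSwinnertonDyer.Rank1Residual.P2

namespace ThetaDescent

variable {m : ℕ} {q : ℕ} {p : Fin m → ℕ}

/-- **The tower theorem with the `2`-Selmer input displayed** (`hSel` on `n ≡ 6 (mod 8)`), otherwise verbatim
`rankOne_sha_bsdp_two_tower_of_cmPointGaloisData`: `q ≡ 3 (mod 4)`, `p₁, …, p_m ≡ 5 (mod 8)` distinct,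
`(pⱼ/pᵢ) = +1`, at most one mark `(pᵢ/q) = −1` and at least one unless `q ≡ 3 (mod 8)`, `n = 2qp₁⋯p_m`:
`ord = 1`, rank `1`, `Ш[2^∞] = 0`, `BSD(E_n, 2)`. Relative to {`tyz_cmPointGaloisData`, TYZ Thm. 1.1, GZK, `hSel`}.
CONDITIONAL; nothing asserted; NOT refereed. [cite: TianYuanZhang2017, §1 (1.1), Thm. 3.5]
[cite: SilvermanAEC2009, Thm. X.4.2] [cite: Miller2011LMS, Def. 1.1 (arXiv:1010.2431 p. 3)] -/
theorem rankOne_sha_bsdp_two_tower_of_cmPointGaloisData_of_selmerSix (hCM : tyz_cmPointGaloisData)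
    (hGZK : rank_eq_analyticRank_of_analyticRank_le_one)
    (hSel : ∀ (k : ℕ) (p : Fin k → ℕ), (∀ i, (p i).Prime) → Function.Injective p →
      (2 * ∏ i, p i) % 8 = 6 →
        Nat.card ((congruentNumberCurve (2 * ∏ i, p i)).selmerGroup 2) =
          2 ^ (2 + monskySelmerRankEven p))
    (h11 : thm11_parity_of_scriptL)
    (hq : q.Prime) (hq4 : q % 4 = 3) (hp : ∀ i, (p i).Prime) (hp5 : ∀ i, p i % 8 = 5) (hinj : Function.Injective p)
    (hQR : ∀ i j, i ≠ j → jacobiSym (p j) (p i) = 1) (hμ : ∀ i j, jacobiSym (p i) q = -1 → jacobiSym (p j) q = -1 → i = j)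
    (hmark : q % 8 = 3 ∨ ∃ a, jacobiSym (p a) q = -1) :
    (congruentNumberCurve (2 * (q * ∏ i, p i))).analyticRank = 1 ∧
      (congruentNumberCurve (2 * (q * ∏ i, p i))).mordellWeilRank = 1 ∧
      AddCommGroup.primaryComponent (congruentNumberCurve (2 * (q * ∏ i, p i))).sha 2 = ⊥ ∧
      BSDp (congruentNumberCurve (2 * (q * ∏ i, p i))) 2 := by
  obtain ⟨hQR', hμ', hmark'⟩ := tower_bits_of_jacobi hq hq4 hp hp5 hinj hQR hμ hmark
  have hsq := squarefree_star' hq hq4 hp hp5 hinj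
  haveI := isElliptic_congruentNumberCurve hsq.ne_zero
  have hn6 := star_mod_eight' hq4 hp hp5 hinj
  obtain ⟨L, hLodd, hL⟩ := exists_odd_isScriptL_tower_of_cmPointGaloisData hCM hGZK h11 hq hq4 hp hp5 hinj hQR' hμ' hmark'
  have hL0' : L ≠ 0 := fun h => by simp [h] at hLodd
  have hL0 : (L : ℚ) ≠ 0 := by exact_mod_cast hL0'
  have hr1 := analyticRank_congruentNumberCurve_eq_one_of_isScriptL hsq (Or.inr (Or.inl hn6)) hL hL0'
  have he : twoExponent (2 * (q * ∏ i, p i)) = 2 * ((m + 1 : ℕ) : ℤ) - 2 := by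
    rw [← prod_star_cons]
    exact twoExponent_two_mul_prod_eq _ (star_cons_prime hq hp) (star_cons_odd' hq4 hp5) (star_cons_injective' hq4 hp5 hinj)
  have hx : deriv (congruentNumberCurve (2 * (q * ∏ i, p i))).entireLFunction 1 =
      (((2 : ℚ) ^ twoExponent (2 * (q * ∏ i, p i)) * (L : ℚ) ^ 2 : ℚ) : ℂ) *
        ((congruentNumberCurve (2 * (q * ∏ i, p i))).realPeriodRat : ℂ) *
          ((congruentNumberCurve (2 * (q * ∏ i, p i))).regulator : ℂ) := by
    rw [← (leadingLCoeff_eq_deriv_of_analyticRank_eq_one hr1).1,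
      leadingLCoeff_congruentNumberCurve_eq_of_isScriptL (Nat.pos_of_ne_zero hsq.ne_zero) hr1 hL]
    push_cast
    ring
  have hn : 2 * ∏ i, (vecCons q p : Fin (m + 1) → ℕ) i = 2 * (q * ∏ i, p i) := by rw [prod_star_cons]
  obtain ⟨hr1', hrk, hsha, hiff⟩ :=
    rankOne_sha_bsdp_two_iff_congruentNumberCurve_two_mul_prod_of_selmerSix (vecCons q p : Fin (m + 1) → ℕ) hGZK hSel
      (star_cons_prime hq hp) (star_cons_injective' hq4 hp5 hinj) hn hn6 (monskySelmerRankEven_tower hq hq4 hp hp5 hQR hμ hmark)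
      (mul_ne_zero (zpow_ne_zero _ two_ne_zero) (pow_ne_zero _ hL0)) hx
  exact ⟨hr1', hrk, hsha, hiff.mpr (by rw [padicValRat_two_zpow_mul_sq hLodd, he])⟩

/-- **The tower theorem relative to {`tyz_cmPointGaloisData`, TYZ Thm. 1.1, GZK, AOKI Thm. 2.2}** (vector form).
CONDITIONAL; nothing asserted; NOT refereed. [cite: Aoki1999, Thm. 2.2 p. 81] [cite: TianYuanZhang2017, §1 (1.1), Thm. 3.5]
[cite: Miller2011LMS, Def. 1.1 (arXiv:1010.2431 p. 3)] -/
theorem rankOne_sha_bsdp_two_tower_of_cmPointGaloisData_of_aoki (hCM : tyz_cmPointGaloisData)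
    (hGZK : rank_eq_analyticRank_of_analyticRank_le_one) (hAo : thm22_card_selmerGroup_two)
    (h11 : thm11_parity_of_scriptL)
    (hq : q.Prime) (hq4 : q % 4 = 3) (hp : ∀ i, (p i).Prime) (hp5 : ∀ i, p i % 8 = 5) (hinj : Function.Injective p)
    (hQR : ∀ i j, i ≠ j → jacobiSym (p j) (p i) = 1) (hμ : ∀ i j, jacobiSym (p i) q = -1 → jacobiSym (p j) q = -1 → i = j)
    (hmark : q % 8 = 3 ∨ ∃ a, jacobiSym (p a) q = -1) :
    (congruentNumberCurve (2 * (q * ∏ i, p i))).analyticRank = 1 ∧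
      (congruentNumberCurve (2 * (q * ∏ i, p i))).mordellWeilRank = 1 ∧
      AddCommGroup.primaryComponent (congruentNumberCurve (2 * (q * ∏ i, p i))).sha 2 = ⊥ ∧
      BSDp (congruentNumberCurve (2 * (q * ∏ i, p i))) 2 :=
  rankOne_sha_bsdp_two_tower_of_cmPointGaloisData_of_selmerSix hCM hGZK (AokiMonsky.monskyEven_six_of_aoki hAo)
    h11 hq hq4 hp hp5 hinj hQR hμ hmark

/-- **THE 𝒮⁻-TOWER THEOREM relative to {`tyz_cmPointGaloisData`, TYZ Thm. 1.1, GZK, AOKI Thm. 2.2}** (route B, uniform in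
the number of prime factors): for `(p₀, q) ∈ 𝒮⁻` (`p₀ ≡ 5 (mod 8)`, `q ≡ 3 (mod 4)`, `(p₀/q) = −1`) and further distinct
primes `p₁, …, p_m ≡ 5 (mod 8)` that are quadratic residues of `q`, of `p₀` and of each other, `n = 2·q·p₀·p₁⋯p_m`:
`ord_{s=1} L(E_n, s) = 1`, rank `E_n(ℚ) = 1`, `Ш(E_n)[2^∞] = 0`, `BSD(E_n, 2)` — verbatim `rankOne_sha_bsdp_two_sminus_tower`
with Aoki's refereed Theorem 2.2 in place of Monsky's even matrix theorem. Nothing asserted; no class booked;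
NOT refereed. [cite: Monsky1990MockHeegner, p. 67 Remark (3)] [cite: TianYuanZhang2017, §1 (1.1), Thm. 1.1, Thm. 3.5]
[cite: Aoki1999, Thm. 2.2 p. 81] [cite: IrelandRosen1990, Ch. 5 §2 Thm. 2] -/
theorem rankOne_sha_bsdp_two_sminus_tower_of_aoki (hCM : tyz_cmPointGaloisData) (hGZK : rank_eq_analyticRank_of_analyticRank_le_one)
    (hAo : thm22_card_selmerGroup_two) (h11 : thm11_parity_of_scriptL) :
    ∀ (m p₀ q : ℕ) (p : Fin m → ℕ), p₀.Prime → q.Prime → p₀ % 8 = 5 → q % 4 = 3 → jacobiSym p₀ q = -1 →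
      (∀ i, (p i).Prime) → (∀ i, p i % 8 = 5) → Function.Injective p →
      (∀ i, jacobiSym (p i) q = 1) → (∀ i, jacobiSym (p i) p₀ = 1) → (∀ i j, i ≠ j → jacobiSym (p j) (p i) = 1) →
      (congruentNumberCurve (2 * (q * (p₀ * ∏ i, p i)))).analyticRank = 1 ∧
        (congruentNumberCurve (2 * (q * (p₀ * ∏ i, p i)))).mordellWeilRank = 1 ∧
        AddCommGroup.primaryComponent (congruentNumberCurve (2 * (q * (p₀ * ∏ i, p i)))).sha 2 = ⊥ ∧
        BSDp (congruentNumberCurve (2 * (q * (p₀ * ∏ i, p i)))) 2 := by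
  intro m p₀ q p hp₀ hq h₀ hq4 hmark hp hp5 hinj hq1 hres hQR
  have hprod : p₀ * ∏ i, p i = ∏ i, (vecCons p₀ p : Fin (m + 1) → ℕ) i := by rw [Fin.prod_univ_succ]; simp
  have hne : ∀ i, p i ≠ p₀ := fun i h => by
    have h1 := hres i; rw [h, jacobiSym.mod_left] at h1
    simp [jacobiSym.zero_left hp₀.one_lt] at h1
  rw [hprod]
  refine rankOne_sha_bsdp_two_tower_of_cmPointGaloisData_of_aoki hCM hGZK hAo h11 hq hq4
    (fun i => Fin.cases (by simpa using hp₀) (fun j => by simpa using hp j) i)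
    (fun i => Fin.cases (by simpa using h₀) (fun j => by simpa using hp5 j) i) ?_ ?_ ?_ (Or.inr ⟨0, by simpa using hmark⟩)
  · have h : Function.Injective (Fin.cons p₀ p : Fin (m + 1) → ℕ) := by
      rw [Fin.cons_injective_iff]
      exact ⟨by rintro ⟨i, hi⟩; exact hne i hi, hinj⟩
    exact h
  · intro i j hij
    induction i using Fin.cases with
    | zero =>
      induction j using Fin.cases with
      | zero => exact absurd rfl hij
      | succ j' => simpa using hres j'
    | succ i' =>
      induction j using Fin.cases with
      | zero =>
        simp only [cons_val_zero, cons_val_succ]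
        rw [jacobiSym.quadratic_reciprocity_one_mod_four (by omega : p₀ % 4 = 1)
          ((hp i').odd_of_ne_two (by have := hp5 i'; omega))]
        exact hres i'
      | succ j' =>
        simp only [cons_val_succ]
        exact hQR i' j' fun h => hij (by rw [h])
  · intro i j hi hj
    have h0 : ∀ i' : Fin m, jacobiSym ((vecCons p₀ p : Fin (m + 1) → ℕ) i'.succ) q ≠ -1 := fun i' => by
      simp only [cons_val_succ]; rw [hq1 i']; decide
    induction i using Fin.cases with
    | zero =>
      induction j using Fin.cases with
      | zero => rfl
      | succ j' => exact absurd hj (h0 j')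
    | succ i' => exact absurd hi (h0 i')

end ThetaDescent

end Summit.BirchSwinnertonDyer.Rank1Residual.P2

end
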